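import Summits.PneNP.PneNP.Theorems.SoloBlindStringHash
import Literature.Computability.Complexity.CodeFPArith
import HarnessLib

/-!
# Hash families written as one bit string (tool for THEOREM E♯)

Support file for the kernel form of THEOREM E♯ of the solo report.  The construction searches,
under `NP ⊆ P`, for a separating hash family by bounded existential quantification over BIT
STRINGS (`SearchToDecision.lean` quantifies over strings only).  This file fixes the reading of a
string `w` as a family of `k` Boolean matrices with `k` rows of length `i` — matrix `j`, row `ρ`
is the block `w[(jk+ρ)i, (jk+ρ+1)i)` — and transports Sipser's Coding Lemma for strings
(`StrHash.exists_sepFamily`, `SoloBlindStringHash.lean`) to this reading: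

* `StrFam.mat k i w j` — matrix `j` of the family read off `w`; `StrFam.codeFP_mat` — reading a
  matrix is polynomial time (`CodeFP.strChunks`);
* `StrFam.mat_flatten` — a well-formed family, flattened to a string, reads back as itself;
* `StrFam.exists_sepString` — **Coding Lemma, string form**: if `X ⊆ {0,1}ⁱ` and `2·|X| ≤ 2ᵏ`,
  some `w` of length `k²i` separates `X`: every `y ∈ X` is isolated by some `mat k i w j`, `j < k`.

All statements proved; no hypotheses beyond those displayed.

References: M. Sipser, *A complexity theoretic approach to randomness*, STOC 1983 (Coding Lemma);
Y. Han, L. A. Hemaspaandra, T. Thierauf, SIAM J. Comput. 26 (1997), Lemma 3.9; S. Arora,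
B. Barak, *Computational Complexity: A Modern Approach*, CUP 2009, §1.3.
-/

namespace Summit.PneNP.PneNP.Theorems.SoloBlind

open Literature.Computability.Complexity
open Literature.Computability.Complexity.CodeFP (natE unE bitE pairE rawE strE pairE_apply)

namespace StrFam

/-! ### Reading a string as a family of matrices -/

/-- Matrix `j` (format `k × i`) of the family written in the string `w`: row `ρ` is the block of
`w` starting at bit `(jk + ρ)i`. [folklore] -/
def mat (k i : ℕ) (w : List Bool) (j : ℕ) : List (List Bool) :=
  (List.range k).map fun ρ => (w.drop ((j * k + ρ) * i)).take i

/-- A matrix read off a string has `k` rows. [folklore] -/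
@[simp] theorem length_mat (k i : ℕ) (w : List Bool) (j : ℕ) : (mat k i w j).length = k := by
  simp [mat]

/-- Hash values under a matrix read off a string have `k` bits. [folklore] -/
@[simp] theorem length_shash_mat (k i : ℕ) (w : List Bool) (j : ℕ) (y : List Bool) :
    (StrHash.shash (mat k i w j) y).length = k := by
  rw [StrHash.length_shash, length_mat]

/-- **Reading a matrix off a string is polynomial time** (arguments: `1ᵏ`, `1ⁱ`, the string, and
the matrix index in binary). [cite: AroraBarak2009, §1.3] -/
theorem codeFP_mat : CodeFP (pairE unE (pairE unE (pairE strE natE))) (rawE strE)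
    (fun t => mat t.1 t.2.1 t.2.2.1 t.2.2.2) := by
  have hk : CodeFP (pairE unE (pairE unE (pairE strE natE))) unE (fun t => t.1) := CodeFP.fst _ _
  have hi : CodeFP (pairE unE (pairE unE (pairE strE natE))) unE (fun t => t.2.1) :=
    (CodeFP.snd _ _).fst'
  have hw : CodeFP (pairE unE (pairE unE (pairE strE natE))) strE (fun t => t.2.2.1) :=
    (CodeFP.snd _ _).snd'.fst'
  have hj : CodeFP (pairE unE (pairE unE (pairE strE natE))) natE (fun t => t.2.2.2) :=
    (CodeFP.snd _ _).snd'.snd'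
  -- the offset `(j k) i` in binary, then in unary capped by `|w|`
  have hoff : CodeFP (pairE unE (pairE unE (pairE strE natE))) natE (fun t => t.2.2.2 * t.1 * t.2.1) :=
    CodeFP.natMul.comp ((CodeFP.natMul.comp (hj.pair (CodeFP.natOfUn.comp hk))).pair
      (CodeFP.natOfUn.comp hi))
  have hcnt : CodeFP (pairE unE (pairE unE (pairE strE natE))) unE
      (fun t => min (t.2.2.2 * t.1 * t.2.1) t.2.2.1.length) :=
    CodeFP.unOfNatMin.comp ((CodeFP.strLength.comp hw).pair hoff)
  have hw' : CodeFP (pairE unE (pairE unE (pairE strE natE))) strE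
      (fun t => t.2.2.1.drop (t.2.2.2 * t.1 * t.2.1)) :=
    (CodeFP.strDrop.comp (hcnt.pair hw)).congr fun t => by
      -- a capped count drops the same (cf. the tree's `Lem75Q.drop_min_length`)
      rcases le_total (t.2.2.2 * t.1 * t.2.1) t.2.2.1.length with h | h
      · rw [min_eq_left h]
      · rw [min_eq_right h, List.drop_length, List.drop_of_length_le h]
  refine (CodeFP.strChunks.comp (hk.pair (hi.pair hw'))).congr fun t => ?_
  obtain ⟨k, i, w, j⟩ := t
  simp only [mat, List.drop_drop]
  refine List.map_congr_left fun ρ _ => ?_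
  congr 2
  ring

/-! ### Flattening a well-formed family -/

/-- A list of rows of length `i` flattens to `(#rows)·i` bits. [folklore] -/
theorem length_flatten_of_forall {H : List (List Bool)} {i : ℕ} (h : ∀ r ∈ H, r.length = i) :
    H.flatten.length = H.length * i := by
  induction H with
  | nil => simp
  | cons r H ih =>
    rw [List.flatten_cons, List.length_append, h r (by simp), ih fun r' hr' => h r' (by simp [hr']),
      List.length_cons]
    ring

/-- Dropping `j` blocks of a flattened list of equal-length blocks. [folklore] -/
theorem drop_mul_flatten {Ls : List (List Bool)} {c : ℕ} (h : ∀ a ∈ Ls, a.length = c) (j : ℕ) :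
    Ls.flatten.drop (j * c) = (Ls.drop j).flatten := by
  induction Ls generalizing j with
  | nil => simp
  | cons a Ls ih =>
    cases j with
    | zero => simp
    | succ j =>
      have ha : a.length = c := h a (by simp)
      rw [List.flatten_cons, List.drop_succ_cons, ← ih (fun a' ha' => h a' (by simp [ha'])) j,
        show (j + 1) * c = a.length + j * c by rw [ha, Nat.succ_mul, Nat.add_comm],
        ← List.drop_drop, List.drop_append_of_le_length (le_refl _), List.drop_length,
        List.nil_append]

/-- **A well-formed family, flattened, reads back as itself.** [folklore] -/
theorem mat_flatten {k i : ℕ} {F : List (List (List Bool))} (hwf : StrHash.wf k i F = true) {j : ℕ}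
    (hj : j < k) : mat k i (F.map List.flatten).flatten j = F.getD j [] := by
  obtain ⟨hFk, hH⟩ := StrHash.wf_eq_true_iff.1 hwf
  have hjF : j < F.length := hFk ▸ hj
  have hrows : ∀ a ∈ F.map List.flatten, a.length = k * i := by
    intro a ha
    obtain ⟨H, hHF, rfl⟩ := List.mem_map.1 ha
    rw [length_flatten_of_forall (hH H hHF).2, (hH H hHF).1]
  have hHj := hH (F[j]) (List.getElem_mem hjF)
  rw [List.getD_eq_getElem _ _ hjF]
  apply List.ext_getElem (by rw [length_mat, hHj.1])
  intro ρ h1 h2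
  rw [length_mat] at h1
  simp only [mat, List.getElem_map, List.getElem_range]
  have hsplit : (j * k + ρ) * i = j * (k * i) + ρ * i := by ring
  have hρi : ρ * i ≤ (F[j]).flatten.length := by
    rw [length_flatten_of_forall hHj.2, hHj.1]
    exact Nat.mul_le_mul_right i h1.le
  have hr : (F[j][ρ]).length = i := hHj.2 _ (List.getElem_mem h2)
  rw [hsplit, ← List.drop_drop, drop_mul_flatten hrows j, ← List.map_drop, List.drop_eq_getElem_cons hjF,
    List.map_cons, List.flatten_cons, List.drop_append_of_le_length hρi, drop_mul_flatten hHj.2 ρ,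
    List.drop_eq_getElem_cons h2, List.flatten_cons, List.append_assoc,
    List.take_append_of_le_length hr.ge, List.take_of_length_le hr.le]

/-- Length of the flattening of a well-formed family. [folklore] -/
theorem length_flatten_wf {k i : ℕ} {F : List (List (List Bool))} (hwf : StrHash.wf k i F = true) :
    (F.map List.flatten).flatten.length = k * k * i := by
  obtain ⟨hFk, hH⟩ := StrHash.wf_eq_true_iff.1 hwf
  rw [length_flatten_of_forall (i := k * i), List.length_map, hFk, Nat.mul_assoc]
  intro a ha
  obtain ⟨H, hHF, rfl⟩ := List.mem_map.1 ha
  rw [length_flatten_of_forall (hH H hHF).2, (hH H hHF).1]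

/-- **Sipser's Coding Lemma, string form.** If `X ⊆ {0,1}ⁱ` and `2·|X| ≤ 2ᵏ`, some bit string `w`
of length `k²i` separates `X`: every `y ∈ X` is isolated within `X` by some matrix `mat k i w j`,
`j < k`. [cite: Sipser1983, Coding Lemma] [cite: HanHemaspaandraThierauf1997, Lemma 3.9] -/
theorem exists_sepString {i k : ℕ} {X : Finset (List Bool)} (hX : ∀ y ∈ X, y.length = i)
    (hcard : 2 * X.card ≤ 2 ^ k) :
    ∃ w : List Bool, w.length = k * k * i ∧ ∀ y ∈ X, ∃ j < k, ∀ z ∈ X, z ≠ y →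
      StrHash.shash (mat k i w j) z ≠ StrHash.shash (mat k i w j) y := by
  obtain ⟨F, hwf, hsep⟩ := StrHash.exists_sepFamily hX hcard
  refine ⟨(F.map List.flatten).flatten, length_flatten_wf hwf, fun y hy => ?_⟩
  obtain ⟨j, hj, hiso⟩ := hsep y hy
  exact ⟨j, hj, fun z hz hne => by rw [mat_flatten hwf hj]; exact hiso z hz hne⟩

end StrFam

end Summit.PneNP.PneNP.Theorems.SoloBlind
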